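import Literature.RingTheory.KTheory.MilnorKStar
import HarnessLib

/-!
# LEMMA 1.1 in the ring `K_*F`: `ηξ = (−1)^{mn} ξη` — even-degree elements are central, odd-degree elements
# anticommute (Milnor, *Algebraic K-theory and quadratic forms*, Invent. Math. 9 (1970), §1)

Family `hodge`, lane `lit-hodgefound` (foundations library; seat `lit-hodgefound-p27`, generation 40, row g40-#13);
topic `RingTheory/KTheory`.  Sequel of `MilnorKRing` (g39-#14: LEMMA 1.1 on the graded pieces,
`MilnorK.mul_graded_comm : mul F n m y x = (−1)^{mn} • castEquiv _ (mul F m n x y)`) and `MilnorKStar` (g40-#7: the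
ring `K_*F`, the multiplicative canonical maps `ofDeg F n : K_nF →+ K_*F`, `iSup_range_ofDeg`).  PROVED THEOREMS only;
no definition, no named fact, no instance, no notation, 0 `sorry`, net debt 0 (D-0026).

## The source, verbatim

J. Milnor, *Algebraic K-theory and quadratic forms*, Invent. Math. 9 (1970) 318–344 (held `paper:doi-10-1007-bf01425486`;
bib key `Milnor1970`), §1 (p0002 L33–L36): «LEMMA 1.1. For every ξ ∈ K_mF and every η ∈ K_nF, the identity
ηξ = (−1)^{mn} ξη is valid in K_{m+n}F. *Proof* (following Steinberg). Clearly it suffices to consider the case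
m = n = 1.»

## What is formalised

LEMMA 1.1 transported into Milnor's ring `K_*F = MilnorKStar F` along the canonical maps `ofDeg` (which are
multiplicative, `ofDeg_mul`, and compatible with the degree identifications, `ofDeg_castEquiv`), split by the parity
of `mn` so that no sign is needed: **`ofDeg_mul_comm_of_even`** (`mn` even: `ηξ = ξη`) and **`ofDeg_mul_add_of_odd`**
(`mn` odd: `ηξ + ξη = 0`), their versions for elements of the images `range (ofDeg F m)`, and the consequences
**`mul_comm_of_mem_range_even`** (elements of even degree are central in `K_*F`, by `iSup_range_ofDeg`),
`ofDeg_two_mul_comm`, **`sq_add_sq_eq_zero_of_odd`** (`x² + x² = 0` for `x` homogeneous of odd degree), and the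
homogeneity of the generators `l_mem_range_ofDeg_one`, `word_mem_range_ofDeg`.

## References

* [Milnor1970] J. Milnor, *Algebraic K-theory and quadratic forms*, Invent. Math. 9 (1970) 318–344 — §1 Lemma 1.1
  (p0002 L33–L45).

Provenance: lane `lit-hodgefound`, seat `lit-hodgefound-p27` gen 40 (agent `literature-prover-lit-hodgefound-p27-g40-0`),
row g40-#13.
-/

set_option autoImplicit false

noncomputable section

namespace Literature.RingTheory.KTheory

namespace MilnorKStar

open Function

section Ring

variable (R : Type*) [CommRing R]

/-- The canonical maps `K_nR → K_*R` are compatible with the degree identifications `K_pR = K_qR`. [cite: Milnor1970, §1 «a graded ring K_*F = (K₀F, K₁F, K₂F, …)» (p0001 L31–L33)] -/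
theorem ofDeg_castEquiv {p q : ℕ} (h : p = q) (x : MilnorK R p) : ofDeg R q (MilnorK.castEquiv h x) = ofDeg R p x := by
  subst h; rfl

end Ring

section Field

variable (F : Type*) [Field F]

/-- **LEMMA 1.1 in the ring `K_*F`, `mn` even: `ηξ = ξη`** for `ξ ∈ K_mF`, `η ∈ K_nF`. [cite: Milnor1970, §1 Lemma 1.1 «ηξ = (−1)^{mn} ξη» (p0002 L33–L35)] -/
theorem ofDeg_mul_comm_of_even {m n : ℕ} (h : Even (m * n)) (x : MilnorK F m) (y : MilnorK F n) :
    ofDeg F n y * ofDeg F m x = ofDeg F m x * ofDeg F n y := by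
  rw [← ofDeg_mul, ← ofDeg_mul, MilnorK.mul_graded_comm, h.neg_one_pow, one_zsmul, ofDeg_castEquiv]

/-- **LEMMA 1.1 in the ring `K_*F`, `mn` odd: `ηξ + ξη = 0`** for `ξ ∈ K_mF`, `η ∈ K_nF`. [cite: Milnor1970, §1 Lemma 1.1 «ηξ = (−1)^{mn} ξη» (p0002 L33–L35)] -/
theorem ofDeg_mul_add_of_odd {m n : ℕ} (h : Odd (m * n)) (x : MilnorK F m) (y : MilnorK F n) :
    ofDeg F n y * ofDeg F m x + ofDeg F m x * ofDeg F n y = 0 := by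
  rw [← ofDeg_mul, ← ofDeg_mul, MilnorK.mul_graded_comm, h.neg_one_pow, neg_one_zsmul, map_neg, ofDeg_castEquiv,
    neg_add_cancel]

/-- Homogeneous elements whose degrees have even product commute. [cite: Milnor1970, §1 Lemma 1.1 «ηξ = (−1)^{mn} ξη» (p0002 L33–L35)] -/
theorem mul_comm_of_mem_range_of_even {m n : ℕ} (h : Even (m * n)) {x y : MilnorKStar F} (hx : x ∈ (ofDeg F m).range)
    (hy : y ∈ (ofDeg F n).range) : x * y = y * x := by
  obtain ⟨x', rfl⟩ := hx
  obtain ⟨y', rfl⟩ := hy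
  exact (ofDeg_mul_comm_of_even F h x' y').symm

/-- Homogeneous elements whose degrees have odd product anticommute: `xy + yx = 0`. [cite: Milnor1970, §1 Lemma 1.1 «ηξ = (−1)^{mn} ξη» (p0002 L33–L35)] -/
theorem mul_add_mul_eq_zero_of_mem_range_of_odd {m n : ℕ} (h : Odd (m * n)) {x y : MilnorKStar F}
    (hx : x ∈ (ofDeg F m).range) (hy : y ∈ (ofDeg F n).range) : x * y + y * x = 0 := by
  obtain ⟨x', rfl⟩ := hx
  obtain ⟨y', rfl⟩ := hy
  rw [add_comm]
  exact ofDeg_mul_add_of_odd F h x' y'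

/-- **Elements of even degree are central in `K_*F`** (`K_*F` is generated by its homogeneous components). [cite: Milnor1970, §1 Lemma 1.1 «ηξ = (−1)^{mn} ξη» (p0002 L33–L35)] -/
theorem mul_comm_of_mem_range_even {m : ℕ} {x : MilnorKStar F} (hx : x ∈ (ofDeg F (2 * m)).range) (y : MilnorKStar F) :
    x * y = y * x := by
  classical
  have hy : y ∈ (⊤ : AddSubgroup (MilnorKStar F)) := trivial
  rw [← iSup_range_ofDeg] at hy
  refine AddSubgroup.iSup_induction (C := fun y => x * y = y * x) _ hy (fun n z hz => ?_) (by rw [mul_zero, zero_mul])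
    (fun a b ha hb => by rw [mul_add, add_mul, ha, hb])
  exact mul_comm_of_mem_range_of_even F ⟨m * n, by ring⟩ hx hz

/-- The image of `K_{2m}F` is central in `K_*F`. [cite: Milnor1970, §1 Lemma 1.1 «ηξ = (−1)^{mn} ξη» (p0002 L33–L35)] -/
theorem ofDeg_two_mul_comm (m : ℕ) (x : MilnorK F (2 * m)) (y : MilnorKStar F) :
    ofDeg F (2 * m) x * y = y * ofDeg F (2 * m) x :=
  mul_comm_of_mem_range_even F ⟨x, rfl⟩ y

/-- **`x² + x² = 0` for `x` homogeneous of odd degree** (`x·x = (−1)^{odd} x·x`). [cite: Milnor1970, §1 Lemma 1.1 «ηξ = (−1)^{mn} ξη» (p0002 L33–L35)] -/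
theorem sq_add_sq_eq_zero_of_odd {m : ℕ} {x : MilnorKStar F} (hx : x ∈ (ofDeg F (2 * m + 1)).range) :
    x * x + x * x = 0 :=
  mul_add_mul_eq_zero_of_mem_range_of_odd F ⟨2 * m * m + 2 * m, by ring⟩ hx hx

/-- `l(a)` is homogeneous of degree `1`. [cite: Milnor1970, §1 «a graded ring K_*F = (K₀F, K₁F, K₂F, …)» (p0001 L31–L33)] -/
theorem l_mem_range_ofDeg_one (a : Fˣ) : l F a ∈ (ofDeg F 1).range :=
  ⟨MilnorK.symbol fun _ => a, ofDeg_one_symbol F _⟩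

/-- A monomial `l(a₁)⋯l(a_k)` is homogeneous of degree `k`. [cite: Milnor1970, §1 «a graded ring K_*F = (K₀F, K₁F, K₂F, …)» (p0001 L31–L33)] -/
theorem word_mem_range_ofDeg (w : List Fˣ) : word F w ∈ (ofDeg F w.length).range :=
  ⟨_, (word_eq_ofDeg F w).symm⟩

end Field

end MilnorKStar

end Literature.RingTheory.KTheory

end
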